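import Mathlib.Data.Fintype.BigOperators
import Mathlib.Data.Finset.Powerset
import Mathlib.Algebra.BigOperators.Group.Finset.Basic
import Mathlib.Data.Fintype.Pi
import Mathlib.Data.Fintype.Powerset
import Mathlib.Data.Fintype.Prod

/-!
# PercRepro — THE LEVEL SUM OF `C₄ + ears`: host types and the kernel-evaluable count (p9, gen 24)

A pattern `g : (Σ j : Fin 4, Fin (k j)) → Finset Bool` of `C₄ + ears` (`RankDistEars`) is sorted by its HOST TYPE
`hostType g j = (exactly one missed ear on j?, some full ear on j?)`. For a host with `m` ears the four types have
`hostCount m` patterns (`2^m`, `3^m − 2^m`, `m·2^{m−1}`, `m·(3^{m−1} − 2^{m−1})`), and the up-set and rank conditions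
of a set depend on its host edges `X` and its host types only (`upCond`, `levelCond`). So the number of rank-`u`
sets above the bottom family is the finite sum `levelSum k u` (proved in `RankDistEarsCount`), which the kernel
evaluates by `decide +kernel` (at `k = (1, 6, 6, 6)`: `levelSum 20 = 49712682990`, `levelSum 21 = 51284660589`).
This file holds the definitions only. Nothing here moves any window of the crux.
-/

namespace PercRepro.RankDist

open Finset

variable (k : Fin 4 → ℕ)

/-- The number of missed ears (`g i = ∅`) on the host `j`. -/
def hostMiss (g : (Σ j : Fin 4, Fin (k j)) → Finset Bool) (j : Fin 4) : ℕ :=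
  (Finset.univ.filter (fun i : (Σ j : Fin 4, Fin (k j)) => i.1 = j ∧ g i = ∅)).card

/-- Whether some ear on the host `j` is full (`g i = univ`). -/
def hostFull (g : (Σ j : Fin 4, Fin (k j)) → Finset Bool) (j : Fin 4) : Bool :=
  decide (∃ i : (Σ j : Fin 4, Fin (k j)), i.1 = j ∧ g i = Finset.univ)

/-- The host type of a pattern at `j`: (exactly one missed ear?, some full ear?). -/
def hostType (g : (Σ j : Fin 4, Fin (k j)) → Finset Bool) (j : Fin 4) : Bool × Bool :=
  (decide (hostMiss k g j = 1), hostFull k g j)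

/-- **The per-host counts**: the patterns `Fin m → Finset Bool` of a host with `m` ears by type —
no miss and no full ear `2^m`; no miss, some full ear `3^m − 2^m`; one miss, no full ear `m·2^{m−1}`;
one miss, some full ear `m·(3^{m−1} − 2^{m−1})`. -/
def hostCount (m : ℕ) : Bool × Bool → ℕ
  | (false, false) => 2 ^ m
  | (false, true) => 3 ^ m - 2 ^ m
  | (true, false) => m * 2 ^ (m - 1)
  | (true, true) => m * (3 ^ (m - 1) - 2 ^ (m - 1))

/-- The hosts with a missed ear, read off a type vector. -/
def typeM (T : Fin 4 → Bool × Bool) : Finset (Fin 4) := Finset.univ.filter (fun j => (T j).1)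

/-- The hosts with a full ear, read off a type vector. -/
def typeF (T : Fin 4 → Bool × Bool) : Finset (Fin 4) := Finset.univ.filter (fun j => (T j).2)

/-- **The up-set condition** on `(X, T)` (every host with at most one missed ear understood): the hosts with a
missed ear lie in `X`, `X` has more elements than there are such hosts, and there are at most two of them. -/
def upCond (X : Finset (Fin 4)) (T : Fin 4 → Bool × Bool) : Bool :=
  decide (typeM T ⊆ X) && decide ((typeM T).card + 1 ≤ X.card) && decide ((typeM T).card ≤ 2)

/-- **The level condition** on `(X, T)` with `K` ears in all: the rank `K − #M + min(#(X ∪ F), 3)` equals `u`. -/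
def levelCond (K u : ℕ) (X : Finset (Fin 4)) (T : Fin 4 → Bool × Bool) : Bool :=
  upCond X T && decide (K - (typeM T).card + min (X ∪ typeF T).card 3 = u)

/-- **The level sum**: `Σ_X Σ_T [levelCond K u X T] · Π_j hostCount (k j) (T j)` — the number of rank-`u` sets of
the up-set of the bottom family of `C₄ + ears`, by `card_shadowLev_ears` (`RankDistEarsCount`). -/
def levelSum (k : Fin 4 → ℕ) (u : ℕ) : ℕ :=
  ∑ X : Finset (Fin 4), ∑ T : Fin 4 → Bool × Bool,
    (if levelCond (∑ j, k j) u X T then ∏ j, hostCount (k j) (T j) else 0)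

end PercRepro.RankDist
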